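import Literature.MathematicalPhysics.QuantumLattice.LiebWuFiniteBCutoffMonotone
import HarnessLib

/-!
# Lieb–Wu 1968, statements (a), (b), (c) — one theorem each, for all allowed `B` and `Q`

Family `hubbard`. E. H. Lieb, F. Y. Wu, Phys. Rev. Lett. 20 (1968) 1445, p. 1446 (reprint p. 67, lines 19–21),
after eqs. (13)–(17): "We have established the following:
(a) Equations (13)–(16) have a unique solution which is positive for all allowed `B` and `Q`.
(b) `M/N` is a monotonically increasing function of `B` reaching a maximum of `½` at `B = ∞`. This is the
    antiferromagnetic case, `S_z = 0`, and corresponds to the absolute ground state.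
(c) `N/N_a` is a monotonically increasing function of `Q`, reaching a maximum of `1` (half-filled band) at
    `Q = π`."
The proofs are Lieb–Wu, Physica A 321 (2003) 1, §5, Theorems 1–3 (with Lemmas 1–5), formalised across
`LiebWuNeumannSeries` … `LiebWuFiniteBCutoffMonotone`. This file only assembles them into the three printed
sentences, each quantified over ARBITRARY solutions `IsLiebWuDensities U Q SΛ ρ σ` (allowed data: `U > 0`,
`0 < Q ≤ π`, range `SΛ = [-B, B]` with `0 < B < ∞` or `SΛ = ℝ` for `B = ∞`; `ρ` is determined on `[-Q, Q]`
and `σ` on `SΛ`, which is all that (13)–(17) involve). No definition, no named fact.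

## References

* E. H. Lieb, F. Y. Wu, Phys. Rev. Lett. 20 (1968) 1445–1448, statements (a)–(c) (key `LiebWuPRL1968`).
* E. H. Lieb, F. Y. Wu, Physica A 321 (2003) 1–27 = arXiv:cond-mat/0207529, §5, Theorems 1–3 (key
  `LiebWuPhysicaA2003`).
-/

noncomputable section

open MeasureTheory Set Real Filter
open scoped Topology

namespace Literature.MathematicalPhysics.QuantumLattice

variable {U Q : ℝ} {SΛ : Set ℝ}

/-- An admissible rapidity range (`[-B, B]` or `ℝ`) is measurable. [folklore] -/
private theorem measurableSet_of_range₂ (h : (∃ B : ℝ, 0 < B ∧ SΛ = Icc (-B) B) ∨ SΛ = univ) :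
    MeasurableSet SΛ := by
  rcases h with ⟨B, _, rfl⟩ | rfl
  · exact measurableSet_Icc
  · exact MeasurableSet.univ

/-- **Lieb–Wu 1968, statement (a):** "Equations (13)–(16) have a unique solution which is positive for all
allowed `B` and `Q`": for `U > 0`, `0 < Q ≤ π` and every admissible range there EXISTS a solution, any two
solutions AGREE (`ρ` on `[-Q, Q]`, `σ` on the range), and every solution is POSITIVE there (`σ > 0` on the
range, `ρ > 0` on `[-Q, Q]` — indeed on all of `ℝ` for the canonical `ρ`, Physica A Lemma 3).
[cite: LiebWuPRL1968, statement (a); LiebWuPhysicaA2003, §5, Theorem 1 and Lemma 3] -/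
theorem liebWu1968_statement_a (hU : 0 < U) (hQ : 0 < Q) (hQπ : Q ≤ π)
    (hrange : (∃ B : ℝ, 0 < B ∧ SΛ = Icc (-B) B) ∨ SΛ = univ) :
    (∃ ρ σ : ℝ → ℝ, IsLiebWuDensities U Q SΛ ρ σ) ∧
      (∀ ρ₁ σ₁ ρ₂ σ₂ : ℝ → ℝ, IsLiebWuDensities U Q SΛ ρ₁ σ₁ → IsLiebWuDensities U Q SΛ ρ₂ σ₂ →
        (∀ k ∈ Icc (-Q) Q, ρ₁ k = ρ₂ k) ∧ ∀ Λ ∈ SΛ, σ₁ Λ = σ₂ Λ) ∧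
      ∀ ρ σ : ℝ → ℝ, IsLiebWuDensities U Q SΛ ρ σ →
        (∀ k ∈ Icc (-Q) Q, 0 < ρ k) ∧ ∀ Λ ∈ SΛ, 0 < σ Λ := by
  have hS := measurableSet_of_range₂ hrange
  refine ⟨⟨_, _, isLiebWuDensities_liebWuRhoAtS_of_range hU hQ hQπ hrange⟩,
    fun ρ₁ σ₁ ρ₂ σ₂ h₁ h₂ => ⟨fun k hk => h₁.rho_unique_on hU hS h₂ hk,
      fun Λ hΛ => IsLiebWuDensities.sigma_unique_on hU hS h₁ h₂ hΛ⟩,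
    fun ρ σ h => ⟨fun k hk => h.rho_pos_on hU hk, fun Λ hΛ => h.sigma_pos_on hU hΛ⟩⟩

/-- **Lieb–Wu 1968, statement (b):** "`M/N` is a monotonically increasing function of `B` reaching a maximum
of `½` at `B = ∞`": for solutions at the same `U, Q` with ranges `[-B₁, B₁] ⊆ [-B₂, B₂]`, `M/N` does not
decrease; for every finite range `M/N < ½`; at `B = ∞`, `M/N = ½`; and the canonical `M/N(B) → ½`.
[cite: LiebWuPRL1968, statement (b); LiebWuPhysicaA2003, §5, Theorem 2] -/
theorem liebWu1968_statement_b (hU : 0 < U) (hQ : 0 < Q) (hQπ : Q ≤ π) :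
    (∀ (B₁ B₂ : ℝ) (ρ₁ σ₁ ρ₂ σ₂ : ℝ → ℝ), B₁ ≤ B₂ →
        IsLiebWuDensities U Q (Icc (-B₁) B₁) ρ₁ σ₁ → IsLiebWuDensities U Q (Icc (-B₂) B₂) ρ₂ σ₂ →
        liebWuDownSpinDensity (Icc (-B₁) B₁) σ₁ / liebWuFilling Q ρ₁ ≤
          liebWuDownSpinDensity (Icc (-B₂) B₂) σ₂ / liebWuFilling Q ρ₂) ∧
      (∀ (B : ℝ) (ρ σ : ℝ → ℝ), 0 < B → IsLiebWuDensities U Q (Icc (-B) B) ρ σ →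
        liebWuDownSpinDensity (Icc (-B) B) σ / liebWuFilling Q ρ < 1 / 2) ∧
      (∀ ρ σ : ℝ → ℝ, IsLiebWuDensities U Q univ ρ σ →
        liebWuDownSpinDensity univ σ / liebWuFilling Q ρ = 1 / 2) ∧
      Tendsto (fun B : ℝ => liebWuDownSpinDensity (Icc (-B) B) (liebWuSigmaAtS U Q (Icc (-B) B)) /
        liebWuFilling Q (liebWuRhoAtS U Q (Icc (-B) B))) atTop (𝓝 (1 / 2)) := by
  refine ⟨fun B₁ B₂ ρ₁ σ₁ ρ₂ σ₂ hB h₁ h₂ => h₁.magnetisation_mono hU hB h₂, fun B ρ σ hB h => ?_,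
    fun ρ σ h => ?_, tendsto_magnetisation_half hU hQ hQπ⟩
  · have hlt := h.two_mul_downSpin_lt_filling hU hB
    have hpos : 0 < liebWuFilling Q ρ := by
      obtain ⟨hf, -, -⟩ := IsLiebWuDensities.functionals_unique_on hU measurableSet_Icc h
        (isLiebWuDensities_liebWuRhoAtS_of_range hU h.cutoff_pos h.cutoff_le_pi h.range_eq)
      rw [hf]
      exact (by positivity : (0 : ℝ) < Q / (2 * π)).trans_le
        (liebWuFilling_liebWuRhoAtS_ge hU h.cutoff_pos h.cutoff_le_pi measurableSet_Icc)
    rw [div_lt_iff₀ hpos]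
    linarith
  · have heq := h.two_mul_downSpin_eq_filling hU
    have hpos : 0 < liebWuFilling Q ρ := by
      obtain ⟨hf, -, -⟩ := IsLiebWuDensities.functionals_unique_on hU MeasurableSet.univ h
        (isLiebWuDensities_liebWuRhoAtS_of_range hU h.cutoff_pos h.cutoff_le_pi h.range_eq)
      rw [hf]
      exact (by positivity : (0 : ℝ) < Q / (2 * π)).trans_le
        (liebWuFilling_liebWuRhoAtS_ge hU h.cutoff_pos h.cutoff_le_pi MeasurableSet.univ)
    rw [div_eq_iff hpos.ne']
    linarith

/-- **Lieb–Wu 1968, statement (c):** "`N/N_a` is a monotonically increasing function of `Q`, reaching a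
maximum of `1` (half-filled band) at `Q = π`": for solutions at the same `U` and range with cutoffs
`Q₁ ≤ Q₂`, `N/N_a` does not decrease (strictly increases if `Q₁ < Q₂`); `N/N_a < 1` for `Q < π` and
`N/N_a = 1` at `Q = π` — for every allowed range (`B ≤ ∞`).
[cite: LiebWuPRL1968, statement (c); LiebWuPhysicaA2003, §5, Theorem 3] -/
theorem liebWu1968_statement_c (hU : 0 < U) :
    (∀ (Q₁ Q₂ : ℝ) (ρ₁ σ₁ ρ₂ σ₂ : ℝ → ℝ), Q₁ ≤ Q₂ →
        IsLiebWuDensities U Q₁ SΛ ρ₁ σ₁ → IsLiebWuDensities U Q₂ SΛ ρ₂ σ₂ →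
        liebWuFilling Q₁ ρ₁ ≤ liebWuFilling Q₂ ρ₂ ∧ (Q₁ < Q₂ → liebWuFilling Q₁ ρ₁ < liebWuFilling Q₂ ρ₂)) ∧
      (∀ (Q : ℝ) (ρ σ : ℝ → ℝ), IsLiebWuDensities U Q SΛ ρ σ →
        (Q < π → liebWuFilling Q ρ < 1) ∧ (Q = π → liebWuFilling Q ρ = 1)) := by
  refine ⟨fun Q₁ Q₂ ρ₁ σ₁ ρ₂ σ₂ hQ h₁ h₂ => ?_, fun Q ρ σ h => ?_⟩
  · obtain ⟨-, -, hle, hlt⟩ := h₁.mono_cutoff hU h₂ hQ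
    exact ⟨hle, hlt⟩
  · obtain ⟨h1, h2⟩ := h.filling_eq_one_or_lt_one hU
    exact ⟨h2, h1⟩

end Literature.MathematicalPhysics.QuantumLattice

end
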